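import Literature.AlgebraicGeometry.Frobenioids.GeometricFrobenioidFrobeniusCompact
import Mathlib.NumberTheory.Padics.PadicVal.Basic
import HarnessLib

/-!
# Frobenioids I, Theorem 6.2 (iii): the zero-or-pole hypothesis is JOINTLY SATISFIABLE with the interface
# `GeometricDivisorData` — a witness at which "`C` is of rationally standard type" is exercised non-vacuously

Mochizuki, *The geometry of Frobenioids I: the general theory*, Kyushu J. Math. **62** (2008) 293–400, Thm. 6.2
(iii), kurims p. 111: "If, moreover, for every finite extension `L ⊆ K̃` of `K`, and every `D ∈ D_L`, it holds that
`D` lies in the support of the image in `Φ(L)^gp` of an element of `B(L)`, then `C` is of rationally standard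
type" [cite: MochizukiFrdI2008, Thm. 6.2 (iii) p.111]; proof p. 112 ll. 4–15 [cite: MochizukiFrdI2008, Thm. 6.2 (iii) p.112];
Ex. 6.1 p. 109 (the data `D_L`, `Φ(L)`, `B(L) ⊆ L^×`, `B(L) → Φ(L)^gp`) [cite: MochizukiFrdI2008, Ex. 6.1 p.109].

PROOF-ONLY (theorems only — the witness is a structure literal inside a proof; cell abc-iut, seat abc-iut-w4-d092
gen 3, RQ7 kernel probe of p422385 `GeometricFrobenioidFrobeniusCompact.lean`, seat abc-iut-L6-t10 gen 3).
The cell types the geometric input of [FrdI] §6 as the INTERFACE `GeometricDivisorData K K̃` (seat abc-iut-L1-t3);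
its only inhabitant in the tree so far, `GeometricDivisorData.trivial` (`GeometricDivisorDataWitness.lean`), has
`B(L) = 1` and `div = 0`, so the printed zero-or-pole hypothesis of Thm. 6.2 (iii) (typed
`∀ X P, ∃ f : Γ.B X, (div X f)(P) ≠ 0`) FAILS there and the second clause of Thm. 6.2 (iii) — "`C` is of rationally
standard type", closed at THE constructions by `geomFrobenioid_isOfRationallyStandardType_rsParams` /
`Thm62iii_rsParams` (p422385) — had only been exercised vacuously.  This file certifies in the kernel that the
hypothesis is jointly satisfiable with all twenty interface fields:

* `GeometricDivisorData.exists_support_witness` — an inhabitant `Γ : GeometricDivisorData ℚ ℚ` (`K = K̃ = ℚ`; one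
  prime divisor `pt` over every `Spec L`; `Φ(L) = ℤ_{≥0}·pt`, saturated and `ℚ`-Cartier; `B(L) = L^×`;
  `div(f) = v₂(f)·pt`, the `2`-adic valuation, natural because the morphisms of `D` act trivially on rational numbers;
  identity "prime below", ramification `1`) at which EVERY prime divisor lies in the support of the divisor of a
  rational function (`div(2) = pt`);
* `GeometricDivisorData.exists_rationallyStandard_witness` — hence, by p422385's theorems, at that `Γ` the Frobenioid
  `C_{K̃/K}` IS of rationally standard type at THE parameters of Def. 4.5 (iii) and every object of THE
  `(C^un-tr)^birat` is Frobenius-compact, with the hypothesis TRUE;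
* `GeometricDivisorData.exists_thm62iii_witness` — and seat abc-iut-L1-t3's typed `Thm62iii` holds there.

HONEST LABEL: `Γ` is an abstract inhabitant of the INTERFACE (which does not see the variety `V`; `ℚ` is not the
function field of a positive-dimensional variety) — it certifies joint satisfiability of the typed hypotheses, not
a geometric example.  Mathlib-level arithmetic only (`padicValRat`); no definition; no statement of the paper is
restated or strengthened; nothing here bears on [IUTchIII] Cor. 3.12 or asserts anything about abc.
-/

noncomputable section

namespace Literature.AlgebraicGeometry.Frobenioids

namespace GeometricDivisorData

open CategoryTheory

/-! ### Arithmetic of the base `D = B(Gal(ℚ/ℚ))⁰`: morphisms fix rational numbers -/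

/-- Elements of an intermediate field of `ℚ/ℚ` are rational numbers: `x = ((x : ℚ) : L)` (Ex. 6.1's objects
`Spec L` for `K = K̃ = ℚ`). [cite: MochizukiFrdI2008, Ex. 6.1 p.109] -/
theorem ratWitness_eq_ratCast (X : FinSubextCat ℚ ℚ) (x : X.L) : x = (((x : ℚ) : ℚ) : X.L) :=
  Subtype.ext (by rw [SubfieldClass.coe_ratCast, Rat.cast_id])

/-- Morphisms `Spec L → Spec M` of `D = B(Gal(ℚ/ℚ))⁰` act trivially on underlying rational numbers (so pulling
back rational functions along them does not change `2`-adic valuations). [cite: MochizukiFrdI2008, Ex. 6.1 p.109] -/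
theorem ratWitness_coe_toAlgHom {X Y : FinSubextCat ℚ ℚ} (σ : Y ⟶ X) (x : X.L) :
    ((σ.toAlgHom x : Y.L) : ℚ) = (x : ℚ) := by
  conv_lhs => rw [ratWitness_eq_ratCast X x]
  rw [map_ratCast, SubfieldClass.coe_ratCast, Rat.cast_id]

/-- Units of `L` have nonzero underlying rational number. [cite: MochizukiFrdI2008, Ex. 6.1 p.109] -/
theorem ratWitness_coe_unit_ne_zero (X : FinSubextCat ℚ ℚ) (u : (X.L)ˣ) : ((u : X.L) : ℚ) ≠ 0 := by
  intro h
  exact u.ne_zero (Subtype.ext (by rw [h]; rfl))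

/-- The rational function `2 ∈ L^×` is nonzero. [cite: MochizukiFrdI2008, Ex. 6.1 p.109] -/
theorem ratWitness_two_ne_zero (X : FinSubextCat ℚ ℚ) : (((2 : ℚ) : ℚ) : X.L) ≠ 0 := by
  intro h
  have h' := congrArg (fun z : X.L => (z : ℚ)) h
  simp only [SubfieldClass.coe_ratCast, ZeroMemClass.coe_zero] at h'
  norm_num at h'

/-- The divisor map of the witness: `B(L) = L^× → ℤ·pt`, `f ↦ v₂(f)·pt` (the `2`-adic valuation of the underlying
rational number), a homomorphism of groups ("`B(L) → Φ(L)^gp` for the natural map", Ex. 6.1 p. 109 — here with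
one prime divisor). [cite: MochizukiFrdI2008, Ex. 6.1 p.109] -/
theorem ratWitness_exists_divHom (X : FinSubextCat ℚ ℚ) :
    ∃ d : (⊤ : Subgroup (X.L)ˣ) →* Multiplicative (Unit →₀ ℤ),
      ∀ f, Multiplicative.toAdd (d f) = Finsupp.single () (padicValRat 2 (((f : (X.L)ˣ) : X.L) : ℚ)) := by
  refine ⟨{ toFun := fun f => Multiplicative.ofAdd (Finsupp.single () (padicValRat 2 (((f : (X.L)ˣ) : X.L) : ℚ)))
            map_one' := ?_
            map_mul' := ?_ }, fun f => rfl⟩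
  · simp
  · intro f g
    rw [← ofAdd_add, ← Finsupp.single_add]
    congr 2
    have hf := ratWitness_coe_unit_ne_zero X (f : (X.L)ˣ)
    have hg := ratWitness_coe_unit_ne_zero X (g : (X.L)ˣ)
    have hfg : (((f * g : (⊤ : Subgroup (X.L)ˣ)) : (X.L)ˣ) : X.L) =
        ((f : (X.L)ˣ) : X.L) * ((g : (X.L)ˣ) : X.L) := by
      simp
    rw [hfg]
    push_cast
    exact padicValRat.mul hf hg

/-! ### The witness and the non-vacuity certificates -/

/-- **The zero-or-pole hypothesis of [FrdI] Thm. 6.2 (iii) is jointly satisfiable with the interface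
`GeometricDivisorData`.** There is an inhabitant `Γ : GeometricDivisorData ℚ ℚ` — one prime divisor `pt` over
every `Spec L`, `Φ(L) = ℤ_{≥0}·pt` (all effective multiples: saturated, `ℚ`-Cartier with `n = 1`), `B(L) = L^×`,
`div(f) = v₂(f)·pt`, identity "prime below" with ramification index `1` — at which, "for every finite extension
`L ⊆ K̃` of `K`, and every `D ∈ D_L`, `D` lies in the support of the image in `Φ(L)^gp` of an element of `B(L)`"
(namely of `2`: `div(2) = pt`).  Abstract inhabitant of the interface, not a geometric example.
[cite: MochizukiFrdI2008, Thm. 6.2 (iii) p.111] -/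
theorem exists_support_witness :
    ∃ Γ : GeometricDivisorData ℚ ℚ,
      ∀ (X : FinSubextCat ℚ ℚ) (P : Γ.primeDiv X), ∃ f : Γ.B X, (Multiplicative.toAdd (Γ.div X f)) P ≠ 0 := by
  classical
  choose d hd using ratWitness_exists_divHom
  refine ⟨{ primeDiv := fun _ => Unit
            Phi := fun _ => ⊤
            B := fun _ => ⊤
            div := d
            over := fun _ Q => Q
            ram := fun _ _ => 1
            ram_pos := fun _ _ => Nat.one_pos
            over_finite := fun _ _ => Set.toFinite _
            over_surjective := fun _ => fun Q => ⟨Q, rfl⟩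
            over_id := fun _ _ => rfl
            ram_id := fun _ _ => rfl
            over_comp := fun _ _ _ => rfl
            ram_comp := fun _ _ _ => rfl
            pull_mem := fun _ _ _ => AddSubmonoid.mem_top _
            map_mem := fun _ _ _ => Subgroup.mem_top _
            div_natural := ?_
            div_mem_gp := ?_
            qCartier := fun _ P => ⟨1, Nat.one_pos, AddSubmonoid.mem_top _⟩
            sub_mem := fun _ _ _ _ _ _ => AddSubmonoid.mem_top _
            primeDiv_nonempty := ⟨⟨⊥⟩, ⟨()⟩⟩ }, ?_⟩
  · -- naturality of `div`: `v₂(σ f) = v₂(f)` since `σ` is the identity on rationals; `e = 1`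
    intro X Y σ f
    rw [hd, hd]
    ext
    simp only [DivisorCoeff.pull_apply, Nat.cast_one, one_mul, Finsupp.single_eq_same]
    congr 1
    simp only [Units.coe_map, MonoidHom.coe_coe]
    exact ratWitness_coe_toAlgHom σ _
  · -- `div(f) ∈ Φ(L)^gp`: `v·pt = v⁺·pt − v⁻·pt`
    intro X f
    refine ⟨Finsupp.single () (padicValRat 2 (((f : (X.L)ˣ) : X.L) : ℚ)).toNat, AddSubmonoid.mem_top _,
      Finsupp.single () (-padicValRat 2 (((f : (X.L)ˣ) : X.L) : ℚ)).toNat, AddSubmonoid.mem_top _, ?_⟩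
    rw [hd]
    ext
    simp only [DivisorCoeff.toInt_apply, Finsupp.coe_sub, Pi.sub_apply, Finsupp.single_eq_same]
    exact (Int.toNat_sub_toNat_neg _).symm
  · -- the support hypothesis: `v₂(2) = 1 ≠ 0`
    intro X P
    obtain ⟨⟩ := P
    refine ⟨⟨Units.mk0 _ (ratWitness_two_ne_zero X), Subgroup.mem_top _⟩, ?_⟩
    change Multiplicative.toAdd (d X _) () ≠ 0
    rw [hd, Finsupp.single_eq_same]
    -- `v₂(2) = 1` (Mathlib `padicValRat.self`)
    have h2 : padicValRat 2 (2 : ℚ) = 1 := by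
      have h := padicValRat.self (p := 2) one_lt_two
      simpa using h
    simp only [Units.val_mk0, SubfieldClass.coe_ratCast, Rat.cast_id, h2]
    exact (one_ne_zero : (1 : ℤ) ≠ 0)

/-- **Thm. 6.2 (iii)'s second clause is exercised NON-VACUOUSLY in the tree**: at the witness `Γ` (hypothesis
TRUE) the Frobenioid `C_{K̃/K}` IS of rationally standard type at THE parameters of Def. 4.5 (iii) and every object
of THE `(C^un-tr)^birat` is Frobenius-compact (seat abc-iut-L6-t10's
`geomFrobenioid_isOfRationallyStandardType_rsParams` / `geomFrobenioid_untrBirat_isFrobeniusCompact_all` BY NAME).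
[cite: MochizukiFrdI2008, Thm. 6.2 (iii) p.112] -/
theorem exists_rationallyStandard_witness :
    ∃ (Γ : GeometricDivisorData ℚ ℚ)
      (_ : ∀ (X : FinSubextCat ℚ ℚ) (P : Γ.primeDiv X), ∃ f : Γ.B X, (Multiplicative.toAdd (Γ.div X f)) P ≠ 0),
      (geomFrobenioidOps Γ).IsOfRationallyStandardType
          (PreFrobenioid.rsParams (geomFrobenioid_isFrobenioid Γ) fun a 𝔭 => PrimarySupp a 𝔭) ∧
        ∀ Y, (PreFrobenioid.rsParams (geomFrobenioid_isFrobenioid Γ) fun a 𝔭 => PrimarySupp a 𝔭).BU.ops.IsFrobeniusCompact Y := by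
  obtain ⟨Γ, hΓ⟩ := exists_support_witness
  exact ⟨Γ, hΓ, geomFrobenioid_isOfRationallyStandardType_rsParams Γ hΓ,
    geomFrobenioid_untrBirat_isFrobeniusCompact_all Γ hΓ⟩

/-- **… and seat abc-iut-L1-t3's typed Thm. 6.2 (iii) `Thm62iii` holds at a datum where the clause's hypothesis
is TRUE** (not only at `GeometricDivisorData.trivial`, where it is vacuous), by `Thm62iii_rsParams` BY NAME.
[cite: MochizukiFrdI2008, Thm. 6.2 (iii) p.111] -/
theorem exists_thm62iii_witness :
    ∃ (Γ : GeometricDivisorData ℚ ℚ)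
      (_ : ∀ (X : FinSubextCat ℚ ℚ) (P : Γ.primeDiv X), ∃ f : Γ.B X, (Multiplicative.toAdd (Γ.div X f)) P ≠ 0),
      Thm62iii (geomModelFrobenioid Γ)
        (PreFrobenioid.biratData (geomFrobenioid_isFrobenioid Γ)
          (PreFrobenioid.hasBiratSquares_of_isFrobenioid (geomFrobenioid_isFrobenioid Γ)))
        (PreFrobenioid.rsParams (geomFrobenioid_isFrobenioid Γ) fun a 𝔭 => PrimarySupp a 𝔭) := by
  obtain ⟨Γ, hΓ⟩ := exists_support_witness
  exact ⟨Γ, hΓ, Thm62iii_rsParams Γ⟩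

end GeometricDivisorData

end Literature.AlgebraicGeometry.Frobenioids

end
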